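import Literature.Probability.Percolation.PositiveAssociationIntegral
import Literature.Analysis.FunctionSpaces.PoissonHarrisFKG
import HarnessLib

/-!
# FKG for two-colour Poisson–Voronoi percolation: black-increasing events are positively correlated

Topic: Probability / Percolation.  Tassion 2016, Prop. 1.2 (FKG inequality for Voronoi
percolation; Bollobás–Riordan, *Percolation* (2006), Ch. 8 Lemma 14): for two BLACK-INCREASING
events `𝓔, 𝓕` (stable under adding black nuclei and deleting white nuclei),
`P[𝓔 ∩ 𝓕] ≥ P[𝓔] P[𝓕]` under the law `PB ⊗ PW` of two independent Poisson processes.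

Proved here from the tree's Harris–FKG inequality for ONE Poisson process
(`IsPoissonPointProcess.harrisFKG_holds`: the law of a Poisson process is positively associated
for the inclusion order) and the tree's stability results `IsPositivelyAssociated.prod`,
`IsPositivelyAssociated.toDual` (`PositiveAssociationIntegral.lean`): black-increasing =
increasing for the order "`B ⊆ B'` and `W ⊇ W'`" = the product of the inclusion order and its
dual (`measure_mul_le_of_isBlackIncreasing`); the decreasing (white-increasing) and finitely-many
forms follow by inclusion–exclusion and induction.

## References
* V. Tassion, Ann. Probab. 44 (2016), Prop. 1.2. [Tassion2016]
* B. Bollobás, O. Riordan, *Percolation*, CUP (2006), Ch. 8, Lemma 14. [BollobasRiordan2006]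
* G. Last, M. Penrose, *Lectures on the Poisson Process* (2017), Thm 20.4. [LastPenrose2017]
-/

noncomputable section

namespace Literature.Probability.Percolation

open _root_.MeasureTheory _root_.Filter _root_.Set
open scoped _root_.ENNReal
open Literature.Analysis.FunctionSpaces

/-! ### Black-increasing events of two-colour configurations -/

section TwoColour

variable {E : Type*} [TopologicalSpace E] [MeasurableSpace E]

/-- An event of pairs of configurations (black nuclei, white nuclei) is **black-increasing** if it
is stable under adding black nuclei and deleting white nuclei (Tassion 2016, §1.2, display before
Prop. 1.2; Bollobás–Riordan 2006, Ch. 8 §8.2). [cite: Tassion2016, §1.2] -/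
def IsBlackIncreasing (A : Set (PointConfig E × PointConfig E)) : Prop :=
  ∀ ⦃ω ω' : PointConfig E × PointConfig E⦄, ω ∈ A → (ω.1 : Set E) ⊆ ω'.1 → (ω'.2 : Set E) ⊆ ω.2 → ω' ∈ A

/-- An event is **black-decreasing** (white-increasing) if its complement is black-increasing,
i.e. it is stable under deleting black nuclei and adding white nuclei. [cite: Tassion2016, §1.2] -/
def IsBlackDecreasing (A : Set (PointConfig E × PointConfig E)) : Prop :=
  ∀ ⦃ω ω' : PointConfig E × PointConfig E⦄, ω ∈ A → (ω'.1 : Set E) ⊆ ω.1 → (ω.2 : Set E) ⊆ ω'.2 → ω' ∈ A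

omit [MeasurableSpace E] in
/-- Black-increasing events are the increasing events for the order "`B ⊆ B'` and `W ⊇ W'`",
i.e. preimages of upper sets of `PointConfig E × (PointConfig E)ᵒᵈ`. [folklore] -/
theorem IsBlackIncreasing.isUpperSet_image {A : Set (PointConfig E × PointConfig E)}
    (hA : IsBlackIncreasing A) :
    IsUpperSet ((Prod.map id OrderDual.toDual) '' A : Set (PointConfig E × (PointConfig E)ᵒᵈ)) := by
  rintro ⟨b, w⟩ ⟨b', w'⟩ ⟨hb, hw⟩ ⟨ω, hω, hωeq⟩
  simp only [Prod.map, id_eq, Prod.mk.injEq] at hωeq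
  obtain ⟨rfl, rfl⟩ := hωeq
  refine ⟨(b', OrderDual.ofDual w'), hA hω hb ?_, rfl⟩
  exact (PointConfig.le_iff_coe_subset.1 (OrderDual.toDual_le_toDual.1 hw))

omit [MeasurableSpace E] in
/-- The complement of a black-decreasing event is black-increasing. [folklore] -/
theorem IsBlackDecreasing.compl {A : Set (PointConfig E × PointConfig E)} (hA : IsBlackDecreasing A) :
    IsBlackIncreasing Aᶜ := fun _ _ hω h1 h2 hω' => hω (hA hω' h1 h2)

variable [T2Space E] [SecondCountableTopology E] [LocallyCompactSpace E] [BorelSpace E]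
  {νB νW : Measure E} [IsLocallyFiniteMeasure νB] [IsLocallyFiniteMeasure νW]
  {PB PW : Measure (PointConfig E)}

/-- **FKG inequality for two-colour Poisson–Voronoi percolation (Tassion 2016, Prop. 1.2;
Bollobás–Riordan 2006, Ch. 8 Lemma 14).**  Under the law `PB ⊗ PW` of two independent Poisson
processes, two black-increasing measurable events satisfy `P[𝓔] P[𝓕] ≤ P[𝓔 ∩ 𝓕]`.
[cite: Tassion2016, Prop 1.2] -/
theorem measure_mul_le_of_isBlackIncreasing (hB : IsPoissonPointProcess νB PB)
    (hW : IsPoissonPointProcess νW PW) {A C : Set (PointConfig E × PointConfig E)}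
    (hA : IsBlackIncreasing A) (hC : IsBlackIncreasing C) (hAm : MeasurableSet A) (hCm : MeasurableSet C) :
    (PB.prod PW) A * (PB.prod PW) C ≤ (PB.prod PW) (A ∩ C) := by
  haveI := hB.isProbabilityMeasure; haveI := hW.isProbabilityMeasure
  have h1 : IsPositivelyAssociated PB := IsPoissonPointProcess.harrisFKG_holds hB
  have h2 : IsPositivelyAssociated PW := IsPoissonPointProcess.harrisFKG_holds hW
  have hmd : Measurable (OrderDual.toDual : PointConfig E → (PointConfig E)ᵒᵈ) := fun s hs => hs
  haveI : IsProbabilityMeasure (PW.map (OrderDual.toDual : PointConfig E → (PointConfig E)ᵒᵈ)) :=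
    Measure.isProbabilityMeasure_map hmd.aemeasurable
  have hprod := h1.prod h2.toDual
  -- transport along `T = id × toDual`, a measurable bijection with measurable inverse
  set T : PointConfig E × PointConfig E → PointConfig E × (PointConfig E)ᵒᵈ :=
    Prod.map id OrderDual.toDual with hTdef
  have hTm : Measurable T := measurable_id.prodMap hmd
  have hTinj : Function.Injective T := fun x y hxy => by
    simpa [T, Prod.map, Prod.ext_iff] using hxy
  have hmapT : (PB.prod (PW.map (OrderDual.toDual : PointConfig E → (PointConfig E)ᵒᵈ))) =
      (PB.prod PW).map T := by
    have := Measure.map_prod_map PB PW measurable_id hmd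
    rw [Measure.map_id] at this
    rw [hTdef, ← this]
  rw [hmapT] at hprod
  have himage : ∀ {S : Set (PointConfig E × PointConfig E)}, MeasurableSet S →
      MeasurableSet (T '' S) ∧ T ⁻¹' (T '' S) = S := by
    intro S hS
    refine ⟨?_, hTinj.preimage_image S⟩
    have : T '' S = (Prod.map id OrderDual.ofDual) ⁻¹' S := by
      ext ⟨b, w⟩
      simp only [T, mem_image, mem_preimage, Prod.map, id_eq, Prod.exists, Prod.mk.injEq]
      constructor
      · rintro ⟨b', w', h, rfl, rfl⟩; exact h
      · intro h; exact ⟨b, OrderDual.ofDual w, h, rfl, rfl⟩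
    rw [this]
    exact (measurable_id.prodMap fun s hs => hs) hS
  obtain ⟨hTA, hTA'⟩ := himage hAm
  obtain ⟨hTC, hTC'⟩ := himage hCm
  have := hprod _ _ hA.isUpperSet_image hC.isUpperSet_image hTA hTC
  rwa [Measure.map_apply hTm hTA, Measure.map_apply hTm hTC, Measure.map_apply hTm (hTA.inter hTC),
    Set.preimage_inter, hTA', hTC'] at this

/-- FKG for two black-decreasing (= white-increasing) events. [cite: Tassion2016, Prop 1.2] -/
theorem measure_mul_le_of_isBlackDecreasing (hB : IsPoissonPointProcess νB PB)
    (hW : IsPoissonPointProcess νW PW) {A C : Set (PointConfig E × PointConfig E)}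
    (hA : IsBlackDecreasing A) (hC : IsBlackDecreasing C) (hAm : MeasurableSet A) (hCm : MeasurableSet C) :
    (PB.prod PW) A * (PB.prod PW) C ≤ (PB.prod PW) (A ∩ C) := by
  haveI := hB.isProbabilityMeasure; haveI := hW.isProbabilityMeasure
  -- inclusion–exclusion from the increasing complements
  have hc := measure_mul_le_of_isBlackIncreasing hB hW hA.compl hC.compl hAm.compl hCm.compl
  set μ := PB.prod PW
  have hcr : μ.real Aᶜ * μ.real Cᶜ ≤ μ.real (Aᶜ ∩ Cᶜ) := by
    rw [measureReal_def, measureReal_def, measureReal_def, ← ENNReal.toReal_mul]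
    exact ENNReal.toReal_mono (measure_ne_top _ _) hc
  rw [← Set.compl_union, probReal_compl_eq_one_sub hAm, probReal_compl_eq_one_sub hCm,
    probReal_compl_eq_one_sub (hAm.union hCm)] at hcr
  have hie := measureReal_union_add_inter (μ := μ) (s := A) hCm
  have hreal : μ.real A * μ.real C ≤ μ.real (A ∩ C) := by nlinarith [hcr, hie]
  rw [measureReal_def, measureReal_def, measureReal_def, ← ENNReal.toReal_mul] at hreal
  exact (ENNReal.toReal_le_toReal (ENNReal.mul_ne_top (measure_ne_top μ A) (measure_ne_top μ C))
    (measure_ne_top μ _)).1 hreal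

/-- **FKG for finitely many black-decreasing events**: `∏ᵢ P[Aᵢ] ≤ P[⋂ᵢ Aᵢ]`.
[cite: Tassion2016, Prop 1.2] -/
theorem finset_prod_measureReal_le_of_isBlackDecreasing (hB : IsPoissonPointProcess νB PB)
    (hW : IsPoissonPointProcess νW PW) {ι : Type*} (s : Finset ι)
    {A : ι → Set (PointConfig E × PointConfig E)} (hA : ∀ i ∈ s, IsBlackDecreasing (A i))
    (hAm : ∀ i ∈ s, MeasurableSet (A i)) :
    ∏ i ∈ s, (PB.prod PW).real (A i) ≤ (PB.prod PW).real (⋂ i ∈ s, A i) := by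
  classical
  haveI := hB.isProbabilityMeasure; haveI := hW.isProbabilityMeasure
  induction s using Finset.induction_on with
  | empty => simp
  | insert j s hj ih =>
    rw [Finset.prod_insert hj, Finset.set_biInter_insert]
    have hA' : ∀ i ∈ s, IsBlackDecreasing (A i) := fun i hi => hA i (Finset.mem_insert_of_mem hi)
    have hAm' : ∀ i ∈ s, MeasurableSet (A i) := fun i hi => hAm i (Finset.mem_insert_of_mem hi)
    have hdec : IsBlackDecreasing (⋂ i ∈ s, A i) := by
      intro ω ω' hω h1 h2
      simp only [mem_iInter] at hω ⊢
      exact fun i hi => hA' i hi (hω i hi) h1 h2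
    have hmeas : MeasurableSet (⋂ i ∈ s, A i) := Finset.measurableSet_biInter _ hAm'
    have h2 := measure_mul_le_of_isBlackDecreasing hB hW (hA j (Finset.mem_insert_self _ _)) hdec
      (hAm j (Finset.mem_insert_self _ _)) hmeas
    have h2r : (PB.prod PW).real (A j) * (PB.prod PW).real (⋂ i ∈ s, A i) ≤
        (PB.prod PW).real (A j ∩ ⋂ i ∈ s, A i) := by
      rw [measureReal_def, measureReal_def, measureReal_def, ← ENNReal.toReal_mul]
      exact ENNReal.toReal_mono (measure_ne_top _ _) h2
    calc (PB.prod PW).real (A j) * ∏ i ∈ s, (PB.prod PW).real (A i)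
        ≤ (PB.prod PW).real (A j) * (PB.prod PW).real (⋂ i ∈ s, A i) :=
          mul_le_mul_of_nonneg_left (ih hA' hAm') measureReal_nonneg
      _ ≤ _ := h2r

end TwoColour

end Literature.Probability.Percolation
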